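import Literature.Algebra.Lie.LefschetzModuleHomogeneousSl2
import Literature.Algebra.Lie.LefschetzModuleKleimanAlgebra
import Literature.Algebra.Lie.LefschetzModuleInvariants
import HarnessLib

/-!
# Looijenga–Lunts (5.3), second paragraph: `𝔞_hor`, the abelian subalgebra `𝔞_{2,0} ⊂ 𝔤(𝔞, M)_{2,0}` and `𝔤(𝔞_{2,0}, M_hor) ⊂ 𝔤(𝔞, M)_{•,0}`

Topic `Literature/Algebra/Lie` (namespace `Literature.Algebra.Lie`).  Lane `lit-hodgefound` (Track 2 foundations
library), skeleton seat `lit-hodgefound-skel-1` (generation 47), row **A1-149** of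
`run/shared/lean/pub/lit-hodgefound/SKELETON.md`.  Sequel of A1-148 (`FilteredLefschetzBigrading.lean`: the bigrading
`h = h_hor + h_ver`, the horizontal filtration `hor^k M = ⊕_{j ≥ k} M_j(h_hor)`) and A1-147
(`LefschetzModuleHomogeneousSl2.lean`: the Proposition of (5.3) for a Lefschetz module, `h_hor, h_ver ∈ 𝔤(𝔞, M)`, the
adjoint bigrading of `𝔤(𝔞, M)`): the SECOND PARAGRAPH of the Proposition of (5.3) — the subspace `𝔞_hor ⊂ 𝔞`, the span
`𝔞_{2,0}` of the lowest horizontal components, and the horizontal Lie algebra `𝔤(𝔞_{2,0}, M_hor)`.  DEFINITIONS WITH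
BODIES (`degreeComponent`, `horizontalPart`, `horizontalTwoZero`) and PROVED theorems only (no named fact, no `sorry`,
no instance, no notation; D-0026 net debt `0`).  As in every `End`-form file of the series the commutator Lie ring of
`𝔤𝔩(M) = Module.End K M` is Mathlib's reducible non-instance `LieRing.ofAssociativeRing`, enabled FILE-LOCALLY.

## Source, VERBATIM

E. Looijenga, V. A. Lunts, *A Lie algebra attached to a projective variety*, Invent. Math. **129** (1997) 361–412
(held TeX text `paper:arxiv-alg-geom_9604014`, page/line numbers of that text), §5 (5.3):

> (p0021 L11–L17) "Suppose now that some `a ∈ 𝔞` preserves the vertical grading (i.e., `e_a(hor^k M) ⊂ hor^{k+2} M`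
> for all `k`) and has the Lefschetz property in `Gr_hor M`: `e_a^k` sends `Gr^{-k}_hor M` isomorphically onto
> `Gr^k_hor M`. It is then immediate that the horizontal filtration is the Lefschetz filtration of the transformation
> `e_a` in `M`."
> (p0021 L27–L30) "The eigen spaces of `(h_hor, h_ver)` under the adjoint representation also define a bigrading of
> `𝔤(𝔞, M)`. The image of `𝔞` in `𝔤(𝔞, M)` need not be bigraded."
> (Proposition, p0021 L32–L43) "Let `𝔞_hor ⊂ 𝔞` be the set of `a ∈ 𝔞` that preserve the vertical grading and suppose
> that `Gr_hor M` is a Lefschetz module of `𝔞_hor`. Then we can write `h = h_hor + h_ver` with `h_hor` and `h_ver`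
> semisimple elements of `𝔤(𝔞, M)` that have integral eigen values and commute with each other (so for the resulting
> bigrading of `M`, `M_{k,l}` gets identified with `Gr^k_hor M_{k+l}`).
> The span of the components of `𝔞_hor` of lowest horizontal degree `2` make up an abelian subalgebra `𝔞_{2,0}` of
> `𝔤(𝔞, M)_{2,0}` that has the Lefschetz property in `M` with respect to the horizontal grading. Moreover,
> `𝔤(𝔞_{2,0}, M_hor)` is a subalgebra of `𝔤(𝔞, M)_{•,0}` that maps isomorphically onto `𝔤(𝔞_hor, Gr_hor M)`."
> (proof, p0021 L55–L63) "Everything follows from the preceding or is obvious except the very last statement. […] in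
> either case the last member is a rational expression in the first two."

and §1 (1.1) p0004 L25–L26: "If `h` and `e` happen to be contained in a semisimple Lie subalgebra `𝔤 ⊂ 𝔤𝔩(M)`, then so
is `f`."; (5.1) p0020 L99–L106 (the Lefschetz filtration of a nilpotent `e` is unique and split by any `𝔰𝔩₂`-triple).

## Rendering (dictionary; the MODEL of A1-148)

* `h_hor = H`, an element of `𝔤(𝔞, M)` of total degree `0` (`H ∈ adDegree K h 0`), `ℤ`-diagonalisable
  (`IsZGrading H`); `h_ver = h - H`; the horizontal filtration `hor^k M = ⨆_{j ≥ k} degreeSpace H j` (A1-148, spelled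
  out); `Gr^k_hor M` is identified with `M_k(H) = degreeSpace H k` by the splitting `hor^k M = M_k(H) ⊕ hor^{k+1} M`
  (A1-148 `horFiltration_eq_sup`, `disjoint_degreeSpace_horFiltration`) — "`M_{k,l}` gets identified with
  `Gr^k_hor M_{k+l}`".  §1 shows that an ABSTRACT horizontal filtration with the printed property IS this one.
* "horizontal degree" of an operator = degree under `ad h_hor` on `𝔤𝔩(M)`: `𝔤𝔩(M)_j(ad H) = adDegree K H j =
  degreeSpace (LieAlgebra.ad K 𝔤𝔩(M) H) j` (`degreeSpace_ad_eq_adDegree`, `rfl`); "the component of `a` of horizontal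
  degree `j`" = `degreeComponent (ad H) j a` (§0); "lowest horizontal degree `2`": `a ∈ ⊕_{j ≥ 2} 𝔤𝔩(M)_j(ad H)`.
* `𝔞_hor = horizontalPart H 𝔞`; `𝔞_{2,0} = horizontalTwoZero H 𝔞 := 𝔞_hor.map (a ↦ a_2)`; `𝔤(𝔞, M)_{k,l}` = `𝔤(𝔞, M) ∩
  adDegree K H k ∩ adDegree K (h - H) l` (A1-147 §3); `𝔤(𝔞_{2,0}, M_hor) = lefschetzLieAlgebra K H 𝔞_{2,0}` (A1-88's
  `𝔤(𝔞', ·)` for the HORIZONTAL grading operator `H`); "`a` has the Lefschetz property in `Gr_hor M`" =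
  `HasLefschetzProperty H a_2` (by `apply_sub_degreeComponent_apply_mem_horFiltration`: `gr(a) = a_2`).

## Contents (all proved; `K` a field of characteristic `0`, `M` finite-dimensional)

* §0 **`degreeComponent A m`** — the component `x ↦ x_m` of `V = ⊕_k V_k(A)`, a polynomial in `A` (REUSING the
  tree's `exists_degreeProj_mem_adjoin` / `degreeProj_apply_mem` / `sum_degreeProj_apply` of
  `LefschetzModuleKleimanAlgebra.lean` §1, predicate form): `degreeComponent_spec`, `…_apply_of_mem[_ne]`,
  `…_apply_mem`, `sum_degreeComponent_apply`, `commute_degreeComponent` (commutes with what commutes with `A`),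
  `degreeComponent_apply_mem_degreeSpace_of_commute`, **`degreeComponent_apply_mem_of_forall_apply_mem`** (components
  of an `A`-stable subspace stay inside), `degreeComponent_apply_eq_zero_of_mem_biSup` /
  `mem_biSup_of_degreeComponent_apply_eq_zero` (support), `eq_zero_of_forall_degreeComponent_apply_eq_zero`,
  `IsZGrading.linearMap_ext`.
* §1 **`eq_horFiltration_of_isMonodromyWeightFiltration`** — "It is then immediate that the horizontal filtration is
  the Lefschetz filtration of `e_a`": a filtration `F` for which `e` is Lefschetz on `Gr_F` (the tree's
  `IsMonodromyWeightFiltration e 0 (i ↦ F (-i))`) equals `⊕_{j ≥ k} M_j(H)` for ANY `𝔰𝔩₂`-triple `(e, H, f)` (uniqueness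
  (5.1) = the tree's `IsMonodromyWeightFiltration.unique`, and A1-148 `isMonodromyWeightFiltration_horFiltration`).
* §2 **`horizontalPart H 𝔞 = 𝔞_hor`**; `map_horFiltration_le_of_mem_adDegree` /
  `apply_mem_horFiltration_of_mem_biSup_adDegree` (operators of horizontal degrees `≥ c` raise `hor` by `c`),
  `IsZGrading.ad`, **`degreeComponent_ad_apply_apply`** (`(a x)_{i+m} = a_m x` on `M_i(H)`),
  **`forall_apply_mem_horFiltration_iff`** / `mem_horizontalPart_iff_mem_biSup` (`a` raises `hor` by `2` iff
  `a ∈ ⊕_{j ≥ 2} 𝔤𝔩(M)_j(ad H)`), `sub_degreeComponent_mem_biSup`, and **`apply_sub_degreeComponent_apply_mem_horFiltration`**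
  (`gr(a) = a_2`: `a x ≡ a_2 x mod hor^{k+3} M` for `x ∈ M_k(H)`).
* §3 **`horizontalTwoZero H 𝔞 = 𝔞_{2,0}`**: `horizontalTwoZero_le_adDegree` (horizontal degree `2`),
  `horizontalTwoZero_le_adDegree_total` (total degree `2`; `ad h` commutes with `ad h_hor`),
  `horizontalTwoZero_le_adDegree_sub_zero` (vertical degree `0`), `lie_mem_biSup_adDegree`
  (`[⊕_{≥c}, ⊕_{≥d}] ⊆ ⊕_{≥c+d}`), and **`lie_eq_zero_of_mem_horizontalTwoZero`: `𝔞_{2,0}` IS ABELIAN**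
  (`[a_2, b_2] = [a, b]_4 = 0`).
* §4 for a Lefschetz module `(𝔞, M)` and `h_hor = H ∈ 𝔤(𝔞, M)` (the data of A1-147 §2
  `IsLefschetzModule.exists_horizontal_vertical`): `degreeComponent_ad_mem_lefschetzLieAlgebra`, **`IsLefschetzModule.horizontalTwoZero_le`** ("an abelian subalgebra
  `𝔞_{2,0}` of `𝔤(𝔞, M)_{2,0}`"), `IsLefschetzModule.mem_lefschetzLieAlgebra_of_isSl2Triple` ((1.1) for `𝔤(𝔞, M)`),
  **`IsLefschetzModule.lefschetzLieAlgebra_horizontalTwoZero_le`** (`𝔤(𝔞_{2,0}, M_hor) ⊂ 𝔤(𝔞, M)`),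
  **`…_le_adDegree_zero`** (`⊂ C(h_ver)`: "the last member is a rational expression in the first two" — A1-143
  `lie_eq_zero_of_isSl2Triple_of_lie_eq_zero` in the adjoint module), **`…_le_iSup`** ("a subalgebra of `𝔤(𝔞, M)_{•,0}`":
  `⊆ ⊕_k 𝔤(𝔞, M)_{k,0}`), `nonempty_lefschetzDomain_horizontalTwoZero` ("has the Lefschetz property in `M` with respect
  to the horizontal grading") and **`IsLefschetzModule.isLefschetzModule_horizontalTwoZero`** (`(𝔞_{2,0}, M_hor)` is a
  Lefschetz module when `Gr_hor M` is one of `𝔞_hor`, in the model).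

## SCOPE

(a) `Gr_hor M` is not constructed as a quotient object: it is MODELLED by `(M, h_hor)` through the splitting of (5.1)
(A1-148), and §2 proves that under this identification `𝔞_hor` acts by `a ↦ a_2`; accordingly the printed hypothesis
"`Gr_hor M` is a Lefschetz module of `𝔞_hor`" is rendered by its two clauses in the model (`HasLefschetzProperty H a_2`
for some `a ∈ 𝔞_hor`; `𝔤(𝔞_{2,0}, M_hor)` semisimple), and "maps isomorphically onto `𝔤(𝔞_hor, Gr_hor M)`" is the
identity of the model — recorded here, not stated as a theorem.  (b) The first sentence of the Proposition
(`h = h_hor + h_ver`) is A1-147 §2; this file takes its output (`H ∈ 𝔤(𝔞, M)`, `IsZGrading H`, `H ∈ adDegree K h 0`) as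
hypotheses.  (c) The third paragraph (the vertical half `𝔞_{0,2}`, `Gr^ver M`, and the injectivity of
`𝔤(𝔞_{2,0}, M_hor) × 𝔤(𝔞_{0,2}, M_ver) → 𝔤(𝔞, M)`) and the Leray application (5.4)–(5.7) are not formalised here.
(d) Nothing here concerns complex tori or the Hodge conjecture.

## References

* [LooijengaLunts1997] E. Looijenga, V. A. Lunts, *A Lie algebra attached to a projective variety*, Invent. Math. 129
  (1997) 361–412; arXiv:alg-geom/9604014. §5 (5.3) p. 21 L11–L17, L27–L30, Proposition L32–L43, proof L55–L63; (5.1)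
  p. 20 L99–L106; §1 (1.1) p. 4 L25–L26 of the held TeX text.
* [CattaniElZeinGriffithsLe2014] E. Cattani et al. (eds.), *Hodge Theory*, Math. Notes 49, App. A Prop. A.2.2 — via
  the tree's `MonodromyWeightFiltration.lean` (`IsMonodromyWeightFiltration.unique`).
* [Andre1996Motifs] Y. André, *Pour une théorie inconditionnelle des motifs*, Publ. Math. IHÉS 83 (1996), §1.2 — via
  the tree's `LefschetzModuleKleimanAlgebra.lean` §1 (degree projectors as polynomials in `h`).
-/

namespace Literature.Algebra.Lie

open Module Function Set LieAlgebra

attribute [local instance 100] LieRing.ofAssociativeRing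

/-! ### §0 Degree components `x ↦ x_m` of a `ℤ`-graded space `V = ⊕_k V_k(A)` -/

section DegreeComponent

variable {K : Type*} [Field K] [CharZero K] {V : Type*} [AddCommGroup V] [Module K V] [FiniteDimensional K V]

/-- **The component of degree `m`**: for an endomorphism `A` of a finite-dimensional `V` (meant: `A` diagonalisable
with integral eigenvalues, `V = ⊕_k V_k(A)`, `IsZGrading A`), `degreeComponent A m` is the projector of `V` onto
`V_m(A)` along `⊕_{k ≠ m} V_k(A)` — a polynomial in `A` (the tree's `exists_degreeProj_mem_adjoin`: the Lagrange
polynomial `∏_{k ≠ m} (m - k)⁻¹ (A - k)` over the finitely many weights, André's Künneth projectors), `x ↦ x_m`, "the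
component of … degree `m`". [cite: LooijengaLunts1997, §5 (5.3) p. 21 L39 ("the components of 𝔞_hor of lowest horizontal degree 2"), (5.2) proof p. 20 L114–L115 ("the 𝔤^{-χ}-component of f'")] [cite: Andre1996Motifs, §1.2 (p. 11, Künneth projectors)] -/
noncomputable def degreeComponent (A : Module.End K V) (m : ℤ) : Module.End K V :=
  Classical.choose (exists_degreeProj_mem_adjoin A m)

/-- `degreeComponent A m` is a polynomial in `A`. [cite: Andre1996Motifs, §1.2 (p. 11, Künneth projectors)] [cite: LooijengaLunts1997, §5 (5.2) proof p. 20 L114–L115] -/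
theorem degreeComponent_mem_adjoin (A : Module.End K V) (m : ℤ) :
    degreeComponent A m ∈ Algebra.adjoin K ({A} : Set (Module.End K V)) :=
  (Classical.choose_spec (exists_degreeProj_mem_adjoin A m)).1

/-- The defining property: on `V_k(A)` the component of degree `m` is the identity if `k = m` and `0` otherwise.
[cite: LooijengaLunts1997, §5 (5.2) proof p. 20 L114–L115] -/
theorem degreeComponent_spec (A : Module.End K V) (m : ℤ) :
    ∀ (k : ℤ) (x : V), x ∈ degreeSpace A k → degreeComponent A m x = if k = m then x else 0 :=
  (Classical.choose_spec (exists_degreeProj_mem_adjoin A m)).2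

/-- `x_m = x` for `x ∈ V_m(A)`. [cite: LooijengaLunts1997, §5 (5.2) proof p. 20 L114–L115] -/
theorem degreeComponent_apply_of_mem {A : Module.End K V} {m : ℤ} {x : V} (hx : x ∈ degreeSpace A m) :
    degreeComponent A m x = x := by
  rw [degreeComponent_spec A m m x hx, if_pos rfl]

/-- `x_m = 0` for `x ∈ V_k(A)`, `k ≠ m`. [cite: LooijengaLunts1997, §5 (5.2) proof p. 20 L114–L115] -/
theorem degreeComponent_apply_of_mem_ne {A : Module.End K V} {m k : ℤ} {x : V} (hx : x ∈ degreeSpace A k)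
    (hkm : k ≠ m) : degreeComponent A m x = 0 := by
  rw [degreeComponent_spec A m k x hx, if_neg hkm]

/-- `x_m ∈ V_m(A)` (for `V = ⊕_k V_k(A)`). [cite: LooijengaLunts1997, §5 (5.2) proof p. 20 L114–L115] -/
theorem degreeComponent_apply_mem {A : Module.End K V} (hA : IsZGrading A) (m : ℤ) (x : V) :
    degreeComponent A m x ∈ degreeSpace A m :=
  degreeProj_apply_mem hA (degreeComponent_spec A m) x

/-- `x = Σ_{m ∈ S} x_m` for any finite set `S` of degrees containing the weights of `V`. [cite: LooijengaLunts1997, §5 (5.2) proof p. 20 L114–L115] -/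
theorem sum_degreeComponent_apply {A : Module.End K V} (hA : IsZGrading A) {S : Finset ℤ}
    (hS : ∀ k : ℤ, degreeSpace A k ≠ ⊥ → k ∈ S) (x : V) : ∑ m ∈ S, degreeComponent A m x = x :=
  sum_degreeProj_apply hA hS (fun m _ ↦ degreeComponent_spec A m) x

/-- An operator commuting with `A` commutes with every component projector (a polynomial in `A`).
[cite: LooijengaLunts1997, §5 (5.3) p. 21 L24–L28 ("This element commutes with h")] -/
theorem commute_degreeComponent {A B : Module.End K V} (hBA : Commute B A) (m : ℤ) :
    Commute B (degreeComponent A m) := by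
  have hle : Algebra.adjoin K ({A} : Set (Module.End K V)) ≤ Subalgebra.centralizer K {B} :=
    Algebra.adjoin_le (Set.singleton_subset_iff.2
      (Set.mem_centralizer_iff.2 fun v hv ↦ by rw [Set.mem_singleton_iff.1 hv]; exact hBA.eq))
  exact Set.mem_centralizer_iff.1 (hle (degreeComponent_mem_adjoin A m)) B (Set.mem_singleton B)

/-- Components of a `B`-eigenvector are `B`-eigenvectors with the same eigenvalue, for `B` commuting with `A` ("the
eigen spaces of the commuting pair `(h_hor, h_ver)` define a bigrading"). [cite: LooijengaLunts1997, §5 (5.3) p. 21 L24–L28] -/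
theorem degreeComponent_apply_mem_degreeSpace_of_commute {A B : Module.End K V} (hBA : Commute B A) {l : ℤ} {x : V}
    (hx : x ∈ degreeSpace B l) (m : ℤ) : degreeComponent A m x ∈ degreeSpace B l := by
  rw [mem_degreeSpace_iff] at hx ⊢
  rw [← Module.End.mul_apply, (commute_degreeComponent hBA m).eq, Module.End.mul_apply, hx, map_smul]

/-- **Components of an element of an `A`-stable subspace `U` lie in `U`** (each component is a polynomial in `A`
applied to the element) — "… also define a bigrading of `𝔤(𝔞, M)`". [cite: LooijengaLunts1997, §5 (5.3) p. 21 L28–L30] -/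
theorem degreeComponent_apply_mem_of_forall_apply_mem {A : Module.End K V} {U : Submodule K V}
    (hU : ∀ x ∈ U, A x ∈ U) (m : ℤ) {x : V} (hx : x ∈ U) : degreeComponent A m x ∈ U := by
  suffices h : ∀ P ∈ Algebra.adjoin K ({A} : Set (Module.End K V)), ∀ y ∈ U, P y ∈ U from
    h _ (degreeComponent_mem_adjoin A m) x hx
  intro P hP
  refine Algebra.adjoin_induction (p := fun P _ ↦ ∀ y ∈ U, P y ∈ U) ?_ ?_ ?_ ?_ hP
  · intro P hP y hy
    rw [Set.mem_singleton_iff.1 hP]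
    exact hU y hy
  · intro r y hy
    rw [Algebra.algebraMap_eq_smul_one, LinearMap.smul_apply, Module.End.one_apply]
    exact U.smul_mem r hy
  · intro P Q _ _ hP hQ y hy
    rw [LinearMap.add_apply]
    exact U.add_mem (hP y hy) (hQ y hy)
  · intro P Q _ _ hP hQ y hy
    rw [Module.End.mul_apply]
    exact hP _ (hQ y hy)

/-- Support: an element of `⊕_{j ∈ S} V_j(A)` has vanishing components outside `S`.
[cite: LooijengaLunts1997, §5 (5.3) p. 21 L39 ("lowest horizontal degree 2")] -/
theorem degreeComponent_apply_eq_zero_of_mem_biSup {A : Module.End K V} {p : ℤ → Prop} {x : V}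
    (hx : x ∈ ⨆ (j : ℤ) (_ : p j), degreeSpace A j) {m : ℤ} (hm : ¬p m) : degreeComponent A m x = 0 := by
  rw [← LinearMap.mem_ker]
  revert hx x
  rw [← SetLike.le_def]
  refine iSup₂_le fun j hj x hx ↦ LinearMap.mem_ker.2 ?_
  exact degreeComponent_apply_of_mem_ne hx fun h ↦ hm (h ▸ hj)

/-- Conversely (for `V = ⊕_k V_k(A)`): if the components of `x` outside `S` vanish then `x ∈ ⊕_{j ∈ S} V_j(A)`.
[cite: LooijengaLunts1997, §5 (5.3) p. 21 L39] -/
theorem mem_biSup_of_degreeComponent_apply_eq_zero {A : Module.End K V} (hA : IsZGrading A) {p : ℤ → Prop} {x : V}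
    (h0 : ∀ m, ¬p m → degreeComponent A m x = 0) : x ∈ ⨆ (j : ℤ) (_ : p j), degreeSpace A j := by
  classical
  rw [← sum_degreeComponent_apply hA (S := (finite_setOf_degreeSpace_ne_bot A).toFinset)
    (fun k hk ↦ (finite_setOf_degreeSpace_ne_bot A).mem_toFinset.2 hk) x]
  refine Submodule.sum_mem _ fun m _ ↦ ?_
  by_cases hm : p m
  · exact Submodule.mem_iSup_of_mem m (Submodule.mem_iSup_of_mem hm (degreeComponent_apply_mem hA m x))
  · rw [h0 m hm]
    exact Submodule.zero_mem _

/-- `V = ⊕_k V_k(A)`: an element all of whose components vanish is `0`. [cite: LooijengaLunts1997, §1 (1.1) p. 3 L106–L111] -/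
theorem eq_zero_of_forall_degreeComponent_apply_eq_zero {A : Module.End K V} (hA : IsZGrading A) {x : V}
    (h0 : ∀ m, degreeComponent A m x = 0) : x = 0 := by
  have h1 := mem_biSup_of_degreeComponent_apply_eq_zero hA (p := fun _ ↦ False) (x := x) fun m _ ↦ h0 m
  simp only [iSup_false, iSup_bot, Submodule.mem_bot] at h1
  exact h1

omit [CharZero K] [FiniteDimensional K V] in
/-- Two endomorphisms of `V = ⊕_k V_k(A)` agreeing on every `V_k(A)` are equal. [cite: LooijengaLunts1997, §1 (1.1) p. 3 L106–L111] -/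
theorem IsZGrading.linearMap_ext {A : Module.End K V} (hA : IsZGrading A) {W : Type*} [AddCommGroup W] [Module K W]
    {a b : V →ₗ[K] W} (h : ∀ k : ℤ, ∀ x ∈ degreeSpace A k, a x = b x) : a = b := by
  refine LinearMap.ext fun x ↦ ?_
  have hx : x ∈ ⨆ k : ℤ, degreeSpace A k := by rw [hA]; exact Submodule.mem_top
  exact Submodule.iSup_induction (fun k : ℤ ↦ degreeSpace A k) (motive := fun x ↦ a x = b x) hx h
    (by rw [map_zero, map_zero]) (fun x y hx hy ↦ by rw [map_add, map_add, hx, hy])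

end DegreeComponent

/-! ### §1 "It is then immediate that the horizontal filtration is the Lefschetz filtration of the transformation `e_a`
in `M`": an abstract horizontal filtration is the eigen-filtration of `h_hor` -/

section AbstractFiltration

variable {K : Type*} [Field K] [CharZero K] {M : Type*} [AddCommGroup M] [Module K M] [FiniteDimensional K M]

/-- **An abstract horizontal filtration on which some `a` has the Lefschetz property in `Gr_hor M` IS
`hor^k M = ⊕_{j ≥ k} M_j(h_hor)`.**  Printed: "Suppose now that some `a ∈ 𝔞` preserves the vertical grading (i.e.,
`e_a(hor^k M) ⊂ hor^{k+2} M` for all `k`) and has the Lefschetz property in `Gr_hor M`: `e_a^k` sends `Gr^{-k}_hor M`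
isomorphically onto `Gr^k_hor M`. It is then immediate that the horizontal filtration is the Lefschetz filtration
of the transformation `e_a` in `M`. If we apply 5.2 … we find an `𝔰𝔩₂`-triple `(e_a, h_hor, f_a)` … It is clear
that the eigen spaces of `h_hor` split the horizontal filtration."  Rendering: a nonincreasing finite filtration
`F = hor^•` of `M` with `e F^k ⊆ F^{k+2}` and `e^k : Gr^{-k}_F ⥲ Gr^k_F` is, after the increasing reindexing
`i ↦ F^{-i}`, a monodromy weight ("Lefschetz", (5.1)) filtration of `e` centred at `0` (the tree's
`IsMonodromyWeightFiltration`, Cattani et al. App. A); by its UNIQUENESS (the tree's `IsMonodromyWeightFiltration.unique`)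
and A1-148 `isMonodromyWeightFiltration_horFiltration`, for ANY `𝔰𝔩₂`-triple `(e, H, f)` of `𝔤𝔩(M)`:
`F^k = ⊕_{j ≥ k} M_j(H)`.  So nothing is lost by working, as A1-148 and this file do, with the filtration
`⊕_{j ≥ k} M_j(H)` of an `𝔰𝔩₂`-triple `(e, H, f)`. [cite: LooijengaLunts1997, §5 (5.3) p. 21 L11–L24, (5.1) p. 20 L99–L106] [cite: CattaniElZeinGriffithsLe2014, App. A Prop. A.2.2] -/
theorem eq_horFiltration_of_isMonodromyWeightFiltration {F : ℤ → Submodule K M} {e H f : Module.End K M}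
    (hF : Literature.AlgebraicGeometry.HodgeTheory.IsMonodromyWeightFiltration e 0 fun i ↦ F (-i))
    (t : IsSl2Triple H e f) (k : ℤ) : F k = ⨆ (j : ℤ) (_ : k ≤ j), degreeSpace H j := by
  have h1 : H * e - e * H = (2 : K) • e := t.lie_h_e_smul K
  have h2 : H * f - f * H = -((2 : K) • f) := t.lie_lie_smul_f K
  have h3 : e * f - f * e = H := t.lie_e_f
  have hW := isMonodromyWeightFiltration_horFiltration t.h_ne_zero h1 h2 h3
  have heq := congr_fun (hF.unique hW) (-k)
  simp only [neg_neg] at heq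
  rw [heq]
  refine le_antisymm (iSup₂_le fun j hj ↦ le_iSup₂_of_le (-j) (by omega) le_rfl)
    (iSup₂_le fun j hj ↦ le_iSup₂_of_le (-j) (by omega) (by rw [neg_neg]))

end AbstractFiltration

/-! ### §2 `𝔞_hor`: "the set of `a ∈ 𝔞` that preserve the vertical grading (i.e., `e_a(hor^k M) ⊂ hor^{k+2} M` for all `k`)" -/

section HorizontalPart

variable {K : Type*} [Field K] [CharZero K] {M : Type*} [AddCommGroup M] [Module K M] [FiniteDimensional K M]

/-- **`𝔞_hor`.**  Printed: "Suppose now that some `a ∈ 𝔞` preserves the vertical grading (i.e., `e_a(hor^k M) ⊂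
hor^{k+2} M` for all `k`) […] Let `𝔞_hor ⊂ 𝔞` be the set of `a ∈ 𝔞` that preserve the vertical grading".  For the
horizontal filtration `hor^k M = ⊕_{j ≥ k} M_j(H)` of `H = h_hor` (§1, A1-148): the subspace of those `a ∈ 𝔞` with
`a (hor^k M) ⊆ hor^{k+2} M` for every `k`. [cite: LooijengaLunts1997, §5 (5.3) p. 21 L11–L13, L32–L33] -/
def horizontalPart (H : Module.End K M) (𝔞 : Submodule K (Module.End K M)) : Submodule K (Module.End K M) where
  carrier := {a | a ∈ 𝔞 ∧ ∀ k : ℤ, ∀ x ∈ ⨆ (j : ℤ) (_ : k ≤ j), degreeSpace H j,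
    a x ∈ ⨆ (j : ℤ) (_ : k + 2 ≤ j), degreeSpace H j}
  add_mem' := fun {a b} ha hb ↦ ⟨𝔞.add_mem ha.1 hb.1, fun k x hx ↦ by
    rw [LinearMap.add_apply]; exact Submodule.add_mem _ (ha.2 k x hx) (hb.2 k x hx)⟩
  zero_mem' := ⟨𝔞.zero_mem, fun k x _ ↦ by rw [LinearMap.zero_apply]; exact Submodule.zero_mem _⟩
  smul_mem' := fun c a ha ↦ ⟨𝔞.smul_mem c ha.1, fun k x hx ↦ by
    rw [LinearMap.smul_apply]; exact Submodule.smul_mem _ c (ha.2 k x hx)⟩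

variable {H : Module.End K M} {𝔞 : Submodule K (Module.End K M)}

omit [CharZero K] [FiniteDimensional K M] in
/-- `a ∈ 𝔞_hor ↔ a ∈ 𝔞 ∧ ∀ k, a (hor^k M) ⊆ hor^{k+2} M`. [cite: LooijengaLunts1997, §5 (5.3) p. 21 L11–L13, L32–L33] -/
theorem mem_horizontalPart_iff {a : Module.End K M} :
    a ∈ horizontalPart H 𝔞 ↔ a ∈ 𝔞 ∧ ∀ k : ℤ, ∀ x ∈ ⨆ (j : ℤ) (_ : k ≤ j), degreeSpace H j,
      a x ∈ ⨆ (j : ℤ) (_ : k + 2 ≤ j), degreeSpace H j :=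
  Iff.rfl

omit [CharZero K] [FiniteDimensional K M] in
/-- … the same with `Submodule.map`. [cite: LooijengaLunts1997, §5 (5.3) p. 21 L11–L13] -/
theorem mem_horizontalPart_iff_map_le {a : Module.End K M} :
    a ∈ horizontalPart H 𝔞 ↔ a ∈ 𝔞 ∧ ∀ k : ℤ, (⨆ (j : ℤ) (_ : k ≤ j), degreeSpace H j).map a ≤
      ⨆ (j : ℤ) (_ : k + 2 ≤ j), degreeSpace H j := by
  refine and_congr Iff.rfl (forall_congr' fun k ↦ ?_)
  rw [Submodule.map_le_iff_le_comap]
  exact ⟨fun h x hx ↦ h x hx, fun h x hx ↦ h hx⟩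

omit [CharZero K] [FiniteDimensional K M] in
/-- `𝔞_hor ⊆ 𝔞`. [cite: LooijengaLunts1997, §5 (5.3) p. 21 L32] -/
theorem horizontalPart_le : horizontalPart H 𝔞 ≤ 𝔞 := fun _ ha ↦ ha.1

omit [CharZero K] [FiniteDimensional K M] in
/-- The horizontal filtration is nonincreasing: `hor^{k'} M ⊆ hor^k M` for `k ≤ k'`. [cite: LooijengaLunts1997, §5 (5.3) p. 21 L1–L3 ("a nonincreasing filtration")] -/
theorem horFiltration_le_of_le (H : Module.End K M) {k k' : ℤ} (hkk' : k ≤ k') :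
    ⨆ (j : ℤ) (_ : k' ≤ j), degreeSpace H j ≤ ⨆ (j : ℤ) (_ : k ≤ j), degreeSpace H j :=
  iSup₂_le fun j hj ↦ le_iSup₂_of_le j (by omega) le_rfl

omit [CharZero K] [FiniteDimensional K M] in
/-- `M_k(H) ⊆ hor^k M`. [cite: LooijengaLunts1997, §5 (5.3) p. 21 L23–L24] -/
theorem degreeSpace_le_horFiltration (H : Module.End K M) (k : ℤ) :
    degreeSpace H k ≤ ⨆ (j : ℤ) (_ : k ≤ j), degreeSpace H j :=
  le_iSup₂_of_le k le_rfl le_rfl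

omit [CharZero K] [FiniteDimensional K M] in
/-- An operator of horizontal degree `c` (`[H, a] = c a`) maps `hor^k M` into `hor^{k+c} M`. [cite: LooijengaLunts1997, §5 (5.3) p. 21 L11–L13, L19–L21] -/
theorem map_horFiltration_le_of_mem_adDegree {a : Module.End K M} {c : ℤ} (ha : a ∈ adDegree K H (c : K)) (k : ℤ) :
    (⨆ (j : ℤ) (_ : k ≤ j), degreeSpace H j).map a ≤ ⨆ (j : ℤ) (_ : k + c ≤ j), degreeSpace H j :=
  Submodule.map_le_iff_le_comap.2 (iSup₂_le fun i hi v hv ↦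
    Submodule.mem_iSup_of_mem (i + c) (Submodule.mem_iSup_of_mem (by omega) (mapsTo_of_mem_adDegree ha i hv)))

omit [CharZero K] [FiniteDimensional K M] in
/-- **Elements of `⊕_{j ≥ c} 𝔤𝔩(M)_j(ad H)` raise the horizontal filtration by `c`**: `a (hor^k M) ⊆ hor^{k+c} M`.
[cite: LooijengaLunts1997, §5 (5.3) p. 21 L11–L13] -/
theorem apply_mem_horFiltration_of_mem_biSup_adDegree {a : Module.End K M} {c : ℤ}
    (ha : a ∈ ⨆ (j : ℤ) (_ : c ≤ j), adDegree K H (j : K)) (k : ℤ) {x : M}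
    (hx : x ∈ ⨆ (j : ℤ) (_ : k ≤ j), degreeSpace H j) : a x ∈ ⨆ (j : ℤ) (_ : k + c ≤ j), degreeSpace H j := by
  revert hx x k
  refine Submodule.iSup_induction (fun j : ℤ ↦ ⨆ (_ : c ≤ j), adDegree K H (j : K))
    (motive := fun a ↦ ∀ (k : ℤ) (x : M), x ∈ ⨆ (j : ℤ) (_ : k ≤ j), degreeSpace H j →
      a x ∈ ⨆ (j : ℤ) (_ : k + c ≤ j), degreeSpace H j) ha (fun j a ha k x hx ↦ ?_)
    (fun k x _ ↦ by rw [LinearMap.zero_apply]; exact Submodule.zero_mem _)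
    (fun a b ha hb k x hx ↦ by rw [LinearMap.add_apply]; exact Submodule.add_mem _ (ha k x hx) (hb k x hx))
  by_cases hcj : c ≤ j
  · rw [iSup_pos hcj] at ha
    exact horFiltration_le_of_le H (by omega) (map_horFiltration_le_of_mem_adDegree ha k ⟨x, hx, rfl⟩)
  · rw [iSup_neg hcj, Submodule.mem_bot] at ha
    rw [ha, LinearMap.zero_apply]
    exact Submodule.zero_mem _

/-- `𝔤𝔩(M)` is `ℤ`-graded by `ad H` for a `ℤ`-diagonalisable `H` (A1-148 `IsZGrading.mulLeft_sub_mulRight`, Mathlib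
`LieAlgebra.ad_eq_lmul_left_sub_lmul_right`). [cite: LooijengaLunts1997, §1 (1.1) p. 4 L56–L58] -/
theorem IsZGrading.ad (hH : IsZGrading H) : IsZGrading (LieAlgebra.ad K (Module.End K M) H) := by
  rw [LieAlgebra.ad_eq_lmul_left_sub_lmul_right]
  exact hH.mulLeft_sub_mulRight

omit [CharZero K] [FiniteDimensional K M] in
/-- `𝔤𝔩(M)_j(ad H) = {a | [H, a] = j a}` as a degree space. [cite: LooijengaLunts1997, §1 (1.1) p. 4 L56–L58] -/
theorem degreeSpace_ad_eq_adDegree (H : Module.End K M) (j : ℤ) :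
    degreeSpace (LieAlgebra.ad K (Module.End K M) H) j = adDegree K H (j : K) :=
  rfl

/-- **The horizontal components of `a x`**: for `x ∈ M_i(H)`, the `M_{i+m}(H)`-component of `a x` is `a_m x`, where
`a_m` is the component of `a` of horizontal degree `m` (under `ad H`). [cite: LooijengaLunts1997, §5 (5.3) p. 21 L39 ("the components of 𝔞_hor of lowest horizontal degree 2")] -/
theorem degreeComponent_ad_apply_apply (hH : IsZGrading H) (a : Module.End K M) (m : ℤ) {i : ℤ} {x : M}
    (hx : x ∈ degreeSpace H i) :
    degreeComponent (LieAlgebra.ad K (Module.End K M) H) m a x = degreeComponent H (i + m) (a x) := by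
  have ha : a ∈ ⨆ j : ℤ, degreeSpace (LieAlgebra.ad K (Module.End K M) H) j := by
    rw [hH.ad]; exact Submodule.mem_top
  refine Submodule.iSup_induction (fun j : ℤ ↦ degreeSpace (LieAlgebra.ad K (Module.End K M) H) j)
    (motive := fun a ↦ degreeComponent (LieAlgebra.ad K (Module.End K M) H) m a x =
      degreeComponent H (i + m) (a x)) ha (fun j a ha ↦ ?_)
    (by rw [map_zero, LinearMap.zero_apply, map_zero])
    (fun a b ha hb ↦ by rw [map_add, LinearMap.add_apply, LinearMap.add_apply, map_add, ha, hb])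
  have hax : a x ∈ degreeSpace H (i + j) := mapsTo_of_mem_adDegree ha i hx
  rw [degreeComponent_spec _ m j a ha, degreeComponent_spec H (i + m) (i + j) (a x) hax]
  by_cases hjm : j = m
  · rw [if_pos hjm, if_pos (by rw [hjm])]
  · rw [if_neg hjm, if_neg (fun h ↦ hjm (by omega)), LinearMap.zero_apply]

/-- **`𝔞_hor` by components: `a` raises the horizontal filtration by `2` iff `a ∈ ⊕_{j ≥ 2} 𝔤𝔩(M)_j(ad H)`** — i.e. iff
the components of `a` of horizontal degree `< 2` vanish, "lowest horizontal degree `2`". [cite: LooijengaLunts1997, §5 (5.3) p. 21 L11–L13, L39] -/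
theorem forall_apply_mem_horFiltration_iff (hH : IsZGrading H) {a : Module.End K M} :
    (∀ k : ℤ, ∀ x ∈ ⨆ (j : ℤ) (_ : k ≤ j), degreeSpace H j, a x ∈ ⨆ (j : ℤ) (_ : k + 2 ≤ j), degreeSpace H j) ↔
      a ∈ ⨆ (j : ℤ) (_ : 2 ≤ j), adDegree K H (j : K) := by
  refine ⟨fun h ↦ ?_, fun ha k x hx ↦ apply_mem_horFiltration_of_mem_biSup_adDegree ha k hx⟩
  simp_rw [← degreeSpace_ad_eq_adDegree]
  refine mem_biSup_of_degreeComponent_apply_eq_zero hH.ad fun m hm ↦ ?_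
  refine hH.linearMap_ext fun i x hx ↦ ?_
  rw [LinearMap.zero_apply, degreeComponent_ad_apply_apply hH a m hx]
  exact degreeComponent_apply_eq_zero_of_mem_biSup (h i x (degreeSpace_le_horFiltration H i hx)) (by omega)

/-- … so `a ∈ 𝔞_hor ↔ a ∈ 𝔞 ∧ a ∈ ⊕_{j ≥ 2} 𝔤𝔩(M)_j(ad H)`. [cite: LooijengaLunts1997, §5 (5.3) p. 21 L32–L33, L39] -/
theorem mem_horizontalPart_iff_mem_biSup (hH : IsZGrading H) {a : Module.End K M} :
    a ∈ horizontalPart H 𝔞 ↔ a ∈ 𝔞 ∧ a ∈ ⨆ (j : ℤ) (_ : 2 ≤ j), adDegree K H (j : K) := by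
  rw [mem_horizontalPart_iff, forall_apply_mem_horFiltration_iff hH]

/-- `a - a_c ∈ ⊕_{j ≥ c+1} 𝔤𝔩(M)_j(ad H)` for `a ∈ ⊕_{j ≥ c} 𝔤𝔩(M)_j(ad H)` (the lowest component removed).
[cite: LooijengaLunts1997, §5 (5.3) p. 21 L39] -/
theorem sub_degreeComponent_mem_biSup (hH : IsZGrading H) {a : Module.End K M} {c : ℤ}
    (ha : a ∈ ⨆ (j : ℤ) (_ : c ≤ j), adDegree K H (j : K)) :
    a - degreeComponent (LieAlgebra.ad K (Module.End K M) H) c a ∈ ⨆ (j : ℤ) (_ : c + 1 ≤ j), adDegree K H (j : K) := by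
  simp_rw [← degreeSpace_ad_eq_adDegree] at ha ⊢
  refine mem_biSup_of_degreeComponent_apply_eq_zero hH.ad fun m hm ↦ ?_
  rw [map_sub]
  rcases eq_or_lt_of_le (show m ≤ c by omega) with rfl | hlt
  · rw [degreeComponent_apply_of_mem (degreeComponent_apply_mem hH.ad m a), sub_self]
  · rw [degreeComponent_apply_eq_zero_of_mem_biSup ha (show ¬c ≤ m by omega),
      degreeComponent_apply_of_mem_ne (degreeComponent_apply_mem hH.ad c a) (ne_of_lt hlt).symm, sub_self]

/-- **`gr(a) = a_{2,0}` on `Gr^k_hor M ≅ M_k(H)`**: for `a` raising the horizontal filtration by `2` and `x ∈ M_k(H)`,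
`a x ≡ a_2 x (mod hor^{k+3} M)` — the operator induced by `a` on `Gr_hor M`, read through the splitting
`hor^k M = M_k(H) ⊕ hor^{k+1} M` (A1-148 `horFiltration_eq_sup`), is the lowest horizontal component `a_2`; this is the
identification behind "maps isomorphically onto `𝔤(𝔞_hor, Gr_hor M)`". [cite: LooijengaLunts1997, §5 (5.3) p. 21 L13–L14, L39–L43] -/
theorem apply_sub_degreeComponent_apply_mem_horFiltration (hH : IsZGrading H) {a : Module.End K M}
    (ha : a ∈ ⨆ (j : ℤ) (_ : 2 ≤ j), adDegree K H (j : K)) {k : ℤ} {x : M} (hx : x ∈ degreeSpace H k) :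
    a x - degreeComponent (LieAlgebra.ad K (Module.End K M) H) 2 a x ∈ ⨆ (j : ℤ) (_ : k + 3 ≤ j), degreeSpace H j := by
  rw [← LinearMap.sub_apply]
  exact apply_mem_horFiltration_of_mem_biSup_adDegree (sub_degreeComponent_mem_biSup hH ha) k
    (degreeSpace_le_horFiltration H k hx)

/-- The lowest horizontal component `a_2` of such an `a` has horizontal degree `2`: `a_2 (M_k(H)) ⊆ M_{k+2}(H)`.
[cite: LooijengaLunts1997, §5 (5.3) p. 21 L39–L41] -/
theorem degreeComponent_ad_apply_mem_degreeSpace (hH : IsZGrading H) (a : Module.End K M) (m : ℤ) {k : ℤ} {x : M}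
    (hx : x ∈ degreeSpace H k) : degreeComponent (LieAlgebra.ad K (Module.End K M) H) m a x ∈ degreeSpace H (k + m) :=
  mapsTo_of_mem_adDegree (degreeComponent_apply_mem hH.ad m a) k hx

end HorizontalPart

/-! ### §3 `𝔞_{2,0}`: "the span of the components of `𝔞_hor` of lowest horizontal degree `2` make up an abelian
subalgebra `𝔞_{2,0}` of `𝔤(𝔞, M)_{2,0}`" -/

section HorizontalTwoZero

variable {K : Type*} [Field K] [CharZero K] {M : Type*} [AddCommGroup M] [Module K M] [FiniteDimensional K M]

/-- **`𝔞_{2,0}`**, "the span of the components of `𝔞_hor` of lowest horizontal degree `2`": the image of `𝔞_hor`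
under `a ↦ a_2`, the component of horizontal degree `2` under `ad h_hor` (`degreeComponent (ad H) 2`).
[cite: LooijengaLunts1997, §5 (5.3) Proposition, p. 21 L39–L40] -/
noncomputable def horizontalTwoZero (H : Module.End K M) (𝔞 : Submodule K (Module.End K M)) : Submodule K (Module.End K M) :=
  (horizontalPart H 𝔞).map (degreeComponent (LieAlgebra.ad K (Module.End K M) H) 2)

variable {H h : Module.End K M} {𝔞 : Submodule K (Module.End K M)}

/-- `x ∈ 𝔞_{2,0} ↔ x = a_2` for some `a ∈ 𝔞_hor`. [cite: LooijengaLunts1997, §5 (5.3) p. 21 L39–L40] -/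
theorem mem_horizontalTwoZero_iff {x : Module.End K M} :
    x ∈ horizontalTwoZero H 𝔞 ↔ ∃ a ∈ horizontalPart H 𝔞, degreeComponent (LieAlgebra.ad K (Module.End K M) H) 2 a = x :=
  Submodule.mem_map

/-- `a_2 ∈ 𝔞_{2,0}` for `a ∈ 𝔞_hor`. [cite: LooijengaLunts1997, §5 (5.3) p. 21 L39–L40] -/
theorem degreeComponent_mem_horizontalTwoZero {a : Module.End K M} (ha : a ∈ horizontalPart H 𝔞) :
    degreeComponent (LieAlgebra.ad K (Module.End K M) H) 2 a ∈ horizontalTwoZero H 𝔞 :=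
  Submodule.mem_map_of_mem ha

/-- `𝔞_{2,0} ⊆ 𝔤𝔩(M)_2(ad h_hor)`: horizontal degree `2`. [cite: LooijengaLunts1997, §5 (5.3) p. 21 L39–L40] -/
theorem horizontalTwoZero_le_adDegree (hH : IsZGrading H) : horizontalTwoZero H 𝔞 ≤ adDegree K H 2 := by
  rintro _ ⟨a, -, rfl⟩
  have h1 : degreeComponent (LieAlgebra.ad K (Module.End K M) H) 2 a ∈ adDegree K H ((2 : ℤ) : K) :=
    degreeComponent_apply_mem hH.ad 2 a
  rwa [Int.cast_two] at h1

omit [CharZero K] [FiniteDimensional K M] in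
/-- `ad h` and `ad H` commute on `𝔤𝔩(M)` when `[h, H] = 0` ("`h_hor` … commutes with `h`").
[cite: LooijengaLunts1997, §5 (5.3) p. 21 L24–L25] -/
theorem commute_ad_of_mem_adDegree_zero (hHh : H ∈ adDegree K h 0) :
    Commute (LieAlgebra.ad K (Module.End K M) h) (LieAlgebra.ad K (Module.End K M) H) := by
  have h0 : ⁅h, H⁆ = 0 := by rw [mem_adDegree_iff.1 hHh, zero_smul]
  have h1 : ⁅LieAlgebra.ad K (Module.End K M) h, LieAlgebra.ad K (Module.End K M) H⁆ = 0 := by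
    rw [← LieHom.map_lie, h0, map_zero]
  rw [Ring.lie_def, sub_eq_zero] at h1
  exact h1

/-- **`𝔞_{2,0} ⊆ 𝔤𝔩(M)_2(ad h)`**: the components of an element of total degree `2` have total degree `2` (`ad h`
commutes with `ad h_hor`). [cite: LooijengaLunts1997, §5 (5.3) p. 21 L39–L40] -/
theorem horizontalTwoZero_le_adDegree_total (hHh : H ∈ adDegree K h 0) (h𝔞 : 𝔞 ≤ adDegree K h 2) :
    horizontalTwoZero H 𝔞 ≤ adDegree K h 2 := by
  rintro _ ⟨a, ha, rfl⟩
  have ha2 : a ∈ degreeSpace (LieAlgebra.ad K (Module.End K M) h) 2 := by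
    rw [degreeSpace_ad_eq_adDegree, Int.cast_two]; exact h𝔞 ha.1
  have h1 := degreeComponent_apply_mem_degreeSpace_of_commute (commute_ad_of_mem_adDegree_zero hHh) ha2 2
  rwa [degreeSpace_ad_eq_adDegree, Int.cast_two] at h1

/-- **`𝔞_{2,0} ⊆ 𝔤𝔩(M)_0(ad h_ver)`**, `h_ver = h - h_hor`: bidegree `(2, 0)`. [cite: LooijengaLunts1997, §5 (5.3) p. 21 L39–L40] -/
theorem horizontalTwoZero_le_adDegree_sub_zero (hH : IsZGrading H) (hHh : H ∈ adDegree K h 0)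
    (h𝔞 : 𝔞 ≤ adDegree K h 2) : horizontalTwoZero H 𝔞 ≤ adDegree K (h - H) 0 := by
  intro x hx
  rw [mem_adDegree_iff, zero_smul, sub_lie, mem_adDegree_iff.1 (horizontalTwoZero_le_adDegree_total hHh h𝔞 hx),
    mem_adDegree_iff.1 (horizontalTwoZero_le_adDegree hH hx), sub_self]

omit [CharZero K] [FiniteDimensional K M] in
/-- `[⊕_{i ≥ c} 𝔤_i, ⊕_{j ≥ d} 𝔤_j] ⊆ ⊕_{m ≥ c+d} 𝔤_m` in any Lie algebra graded by `ad h` (`[𝔤_i, 𝔤_j] ⊆ 𝔤_{i+j}`,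
the tree's `lie_mem_adDegree`). [cite: LooijengaLunts1997, §1 (1.1) p. 4 L56–L58] -/
theorem lie_mem_biSup_adDegree {L : Type*} [LieRing L] [LieAlgebra K L] {h x y : L} {c d : ℤ}
    (hx : x ∈ ⨆ (i : ℤ) (_ : c ≤ i), adDegree K h (i : K)) (hy : y ∈ ⨆ (j : ℤ) (_ : d ≤ j), adDegree K h (j : K)) :
    ⁅x, y⁆ ∈ ⨆ (m : ℤ) (_ : c + d ≤ m), adDegree K h (m : K) := by
  -- homogeneous `x` first: `⊕_{j ≥ d} 𝔤_j ⊆ (ad x)⁻¹ (⊕_{m ≥ i+d} 𝔤_m)` for `x ∈ 𝔤_i`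
  have step : ∀ (i : ℤ) (x : L), x ∈ adDegree K h (i : K) →
      (⨆ (j : ℤ) (_ : d ≤ j), adDegree K h (j : K)) ≤
        (⨆ (m : ℤ) (_ : i + d ≤ m), adDegree K h (m : K)).comap (LieAlgebra.ad K L x) := by
    intro i x hx
    refine iSup₂_le fun j hj y hy ↦ ?_
    rw [Submodule.mem_comap, LieAlgebra.ad_apply]
    have h1 := lie_mem_adDegree hx hy
    rw [← Int.cast_add] at h1
    exact Submodule.mem_iSup_of_mem (i + j) (Submodule.mem_iSup_of_mem (by omega) h1)
  -- general `x`: the set of good `x` contains every `𝔤_i`, `i ≥ c`, and is a subspace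
  suffices hall : ∀ y', y' ∈ ⨆ (j : ℤ) (_ : d ≤ j), adDegree K h (j : K) →
      ⁅x, y'⁆ ∈ ⨆ (m : ℤ) (_ : c + d ≤ m), adDegree K h (m : K) from hall y hy
  refine Submodule.iSup_induction (fun i : ℤ ↦ ⨆ (_ : c ≤ i), adDegree K h (i : K))
    (motive := fun x ↦ ∀ y', y' ∈ ⨆ (j : ℤ) (_ : d ≤ j), adDegree K h (j : K) →
      ⁅x, y'⁆ ∈ ⨆ (m : ℤ) (_ : c + d ≤ m), adDegree K h (m : K)) hx (fun i x hx y' hy' ↦ ?_)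
    (fun _ _ ↦ by rw [zero_lie]; exact Submodule.zero_mem _)
    (fun a b ha hb y' hy' ↦ by rw [add_lie]; exact Submodule.add_mem _ (ha y' hy') (hb y' hy'))
  by_cases hci : c ≤ i
  · rw [iSup_pos hci] at hx
    have h1 : ⁅x, y'⁆ ∈ ⨆ (m : ℤ) (_ : i + d ≤ m), adDegree K h (m : K) := step i x hx hy'
    have hle : (⨆ (m : ℤ) (_ : i + d ≤ m), adDegree K h (m : K)) ≤ ⨆ (m : ℤ) (_ : c + d ≤ m), adDegree K h (m : K) :=
      iSup₂_le fun m hm ↦ le_iSup₂_of_le m (by omega) le_rfl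
    exact hle h1
  · rw [iSup_neg hci, Submodule.mem_bot] at hx
    rw [hx, zero_lie]
    exact Submodule.zero_mem _

/-- **`𝔞_{2,0}` is abelian** ("make up an abelian subalgebra `𝔞_{2,0}`"): for commuting `a, b ∈ 𝔞_hor` the lowest
components commute, `[a_2, b_2] = [a, b]_4 = 0`. [cite: LooijengaLunts1997, §5 (5.3) Proposition, p. 21 L39–L40] -/
theorem lie_eq_zero_of_mem_horizontalTwoZero (hH : IsZGrading H) (h𝔞 : ∀ a ∈ 𝔞, ∀ b ∈ 𝔞, ⁅a, b⁆ = 0)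
    {x y : Module.End K M} (hx : x ∈ horizontalTwoZero H 𝔞) (hy : y ∈ horizontalTwoZero H 𝔞) : ⁅x, y⁆ = 0 := by
  obtain ⟨a, ha, rfl⟩ := hx
  obtain ⟨b, hb, rfl⟩ := hy
  have hab : ⁅a, b⁆ = 0 := h𝔞 a ha.1 b hb.1
  have ha2 := ((mem_horizontalPart_iff_mem_biSup hH).1 ha).2
  have hb2 := ((mem_horizontalPart_iff_mem_biSup hH).1 hb).2
  have ha3 := sub_degreeComponent_mem_biSup hH ha2
  have hb3 := sub_degreeComponent_mem_biSup hH hb2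
  have hca : degreeComponent (LieAlgebra.ad K (Module.End K M) H) 2 a ∈ adDegree K H ((2 : ℤ) : K) :=
    degreeComponent_apply_mem hH.ad 2 a
  have hcb : degreeComponent (LieAlgebra.ad K (Module.End K M) H) 2 b ∈ adDegree K H ((2 : ℤ) : K) :=
    degreeComponent_apply_mem hH.ad 2 b
  generalize degreeComponent (LieAlgebra.ad K (Module.End K M) H) 2 a = a₂ at ha3 hca ⊢
  generalize degreeComponent (LieAlgebra.ad K (Module.End K M) H) 2 b = b₂ at hb3 hcb ⊢
  have hca' : a₂ ∈ ⨆ (j : ℤ) (_ : (2 : ℤ) ≤ j), adDegree K H (j : K) :=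
    Submodule.mem_iSup_of_mem (2 : ℤ) (Submodule.mem_iSup_of_mem le_rfl hca)
  -- `[a, b] = [a_2, b_2] + R` with `R` of horizontal degrees `≥ 5`
  have e1 : ⁅a, b⁆ = ⁅a₂, b₂⁆ + (⁅a₂, b - b₂⁆ + ⁅a - a₂, b⁆) := by
    rw [lie_sub, sub_lie]; abel
  have hR : ⁅a₂, b - b₂⁆ + ⁅a - a₂, b⁆ ∈ ⨆ (m : ℤ) (_ : (5 : ℤ) ≤ m), adDegree K H (m : K) := by
    have h1 : ⁅a₂, b - b₂⁆ ∈ ⨆ (m : ℤ) (_ : (2 : ℤ) + (2 + 1) ≤ m), adDegree K H (m : K) :=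
      lie_mem_biSup_adDegree hca' hb3
    have h2 : ⁅a - a₂, b⁆ ∈ ⨆ (m : ℤ) (_ : (2 : ℤ) + 1 + 2 ≤ m), adDegree K H (m : K) :=
      lie_mem_biSup_adDegree ha3 hb2
    simp only [show (2 : ℤ) + (2 + 1) = 5 by norm_num] at h1
    simp only [show (2 : ℤ) + 1 + 2 = 5 by norm_num] at h2
    exact Submodule.add_mem _ h1 h2
  have h4 : ⁅a₂, b₂⁆ ∈ degreeSpace (LieAlgebra.ad K (Module.End K M) H) 4 := by
    have h1 := lie_mem_adDegree hca hcb
    rw [← Int.cast_add, show (2 : ℤ) + 2 = 4 by norm_num] at h1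
    exact h1
  have h0 : degreeComponent (LieAlgebra.ad K (Module.End K M) H) 4 ⁅a, b⁆ = 0 := by rw [hab, map_zero]
  simp_rw [← degreeSpace_ad_eq_adDegree] at hR
  rwa [e1, map_add, degreeComponent_apply_of_mem h4, degreeComponent_apply_eq_zero_of_mem_biSup hR (by omega),
    add_zero] at h0

end HorizontalTwoZero

/-! ### §4 For a Lefschetz module: `𝔞_{2,0} ⊂ 𝔤(𝔞, M)_{2,0}` and `𝔤(𝔞_{2,0}, M_hor) ⊂ 𝔤(𝔞, M)_{•,0}` -/

section LefschetzModule

variable {K : Type*} [Field K] [CharZero K] {M : Type*} [AddCommGroup M] [Module K M] [FiniteDimensional K M]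
  {h H : Module.End K M} {𝔞 : Submodule K (Module.End K M)}

/-- The components (under `ad H`, `H ∈ 𝔤(𝔞, M)`) of an element of `𝔤(𝔞, M)` lie in `𝔤(𝔞, M)` — "the eigen spaces
of `(h_hor, h_ver)` under the adjoint representation also define a bigrading of `𝔤(𝔞, M)`" (A1-147 §3); here via
§0: `𝔤(𝔞, M)` is `ad H`-stable and each component is a polynomial in `ad H`. [cite: LooijengaLunts1997, §5 (5.3) p. 21 L28–L30] -/
theorem degreeComponent_ad_mem_lefschetzLieAlgebra (hH𝔤 : H ∈ lefschetzLieAlgebra K h 𝔞) (m : ℤ)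
    {x : Module.End K M} (hx : x ∈ lefschetzLieAlgebra K h 𝔞) :
    degreeComponent (LieAlgebra.ad K (Module.End K M) H) m x ∈ lefschetzLieAlgebra K h 𝔞 :=
  degreeComponent_apply_mem_of_forall_apply_mem (U := (lefschetzLieAlgebra K h 𝔞).toSubmodule)
    (fun _ hy ↦ (lefschetzLieAlgebra K h 𝔞).lie_mem hH𝔤 hy) m hx

/-- **`𝔞_{2,0} ⊂ 𝔤(𝔞, M)`** (`𝔞_hor ⊆ 𝔞 ⊆ 𝔤(𝔞, M)` and components stay inside). [cite: LooijengaLunts1997, §5 (5.3) Proposition, p. 21 L39–L40] -/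
theorem horizontalTwoZero_le_lefschetzLieAlgebra (hH𝔤 : H ∈ lefschetzLieAlgebra K h 𝔞) :
    horizontalTwoZero H 𝔞 ≤ (lefschetzLieAlgebra K h 𝔞).toSubmodule := by
  rintro _ ⟨a, ha, rfl⟩
  exact degreeComponent_ad_mem_lefschetzLieAlgebra hH𝔤 2 (mem_lefschetzLieAlgebra_of_mem ha.1)

/-- **LOOIJENGA–LUNTS (5.3): "`𝔞_{2,0}` … an abelian subalgebra of `𝔤(𝔞, M)_{2,0}`"** for a Lefschetz module `(𝔞, M)`
and `h = h_hor + h_ver` as in the Proposition (`H = h_hor ∈ 𝔤(𝔞, M)` of total degree `0`, `ℤ`-diagonalisable;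
A1-147 §2 `IsLefschetzModule.exists_horizontal_vertical`): `𝔞_{2,0} ⊆ 𝔤(𝔞, M) ∩ 𝔤𝔩(M)_2(ad h_hor) ∩
𝔤𝔩(M)_0(ad h_ver)` and `[𝔞_{2,0}, 𝔞_{2,0}] = 0`. [cite: LooijengaLunts1997, §5 (5.3) Proposition, p. 21 L32–L40] -/
theorem IsLefschetzModule.horizontalTwoZero_le (A : IsLefschetzModule K h 𝔞) (hH𝔤 : H ∈ lefschetzLieAlgebra K h 𝔞)
    (hH : IsZGrading H) (hHh : H ∈ adDegree K h 0) :
    horizontalTwoZero H 𝔞 ≤ (lefschetzLieAlgebra K h 𝔞).toSubmodule ⊓ (adDegree K H 2 ⊓ adDegree K (h - H) 0) ∧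
      ∀ x ∈ horizontalTwoZero H 𝔞, ∀ y ∈ horizontalTwoZero H 𝔞, ⁅x, y⁆ = 0 :=
  ⟨le_inf (horizontalTwoZero_le_lefschetzLieAlgebra hH𝔤)
      (le_inf (horizontalTwoZero_le_adDegree hH) (horizontalTwoZero_le_adDegree_sub_zero hH hHh A.le_adDegree_two)),
    fun _ hx _ hy ↦ lie_eq_zero_of_mem_horizontalTwoZero hH A.lie_eq_zero hx hy⟩

/-- **"If `h` and `e` happen to be contained in a semisimple Lie subalgebra `𝔤 ⊂ 𝔤𝔩(M)`, then so is `f`"** for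
`𝔤 = 𝔤(𝔞, M)` of a Lefschetz module (A1-101 `mem_of_isSl2Triple`): the partner of an `𝔰𝔩₂`-triple `(e, h', f)` with
`h', e ∈ 𝔤(𝔞, M)` lies in `𝔤(𝔞, M)`. [cite: LooijengaLunts1997, §1 (1.1) p. 4 L25–L26; §5 (5.3) p. 21 L41–L43] -/
theorem IsLefschetzModule.mem_lefschetzLieAlgebra_of_isSl2Triple (A : IsLefschetzModule K h 𝔞)
    {h' e f : Module.End K M} (hh' : h' ∈ lefschetzLieAlgebra K h 𝔞) (he : e ∈ lefschetzLieAlgebra K h 𝔞)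
    (t : IsSl2Triple h' e f) : f ∈ lefschetzLieAlgebra K h 𝔞 := by
  haveI := A.isSemisimple
  exact mem_of_isSl2Triple (lefschetzLieAlgebra K h 𝔞) hh' he t

/-- **`𝔤(𝔞_{2,0}, M_hor) ⊂ 𝔤(𝔞, M)`**: the Lie subalgebra of `𝔤𝔩(M)` generated by `𝔞_{2,0}` and the partners `f_x`
(with respect to the HORIZONTAL grading `H = h_hor`) of its Lefschetz elements is contained in `𝔤(𝔞, M)` — the
generators are: `𝔞_{2,0} ⊆ 𝔤(𝔞, M)` and each partner by (1.1) (`h_hor, x ∈ 𝔤(𝔞, M)` semisimple).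
[cite: LooijengaLunts1997, §5 (5.3) Proposition, p. 21 L41–L43; §1 (1.1) p. 4 L25–L26] -/
theorem IsLefschetzModule.lefschetzLieAlgebra_horizontalTwoZero_le (A : IsLefschetzModule K h 𝔞)
    (hH𝔤 : H ∈ lefschetzLieAlgebra K h 𝔞) :
    lefschetzLieAlgebra K H (horizontalTwoZero H 𝔞) ≤ lefschetzLieAlgebra K h 𝔞 := by
  rw [lefschetzLieAlgebra_le_iff]
  refine ⟨fun x hx ↦ horizontalTwoZero_le_lefschetzLieAlgebra hH𝔤 hx, ?_⟩
  rintro f ⟨x, hx, t⟩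
  exact A.mem_lefschetzLieAlgebra_of_isSl2Triple hH𝔤 (horizontalTwoZero_le_lefschetzLieAlgebra hH𝔤 hx) t

omit [CharZero K] [FiniteDimensional K M] in
/-- The centraliser of `W` inside a Lie subalgebra `G`: `{x ∈ G | [W, x] = 0}` is a Lie subalgebra. [folklore] -/
private theorem exists_lieSubalgebra_inf_adDegree_zero (G : LieSubalgebra K (Module.End K M)) (W : Module.End K M) :
    ∃ C : LieSubalgebra K (Module.End K M), C.toSubmodule = G.toSubmodule ⊓ adDegree K W 0 :=
  ⟨{ (G.toSubmodule ⊓ adDegree K W 0 : Submodule K (Module.End K M)) with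
      lie_mem' := fun {x y} hx hy ↦ ⟨G.lie_mem hx.1 hy.1, by
        have h1 := lie_mem_adDegree hx.2 hy.2
        rwa [add_zero] at h1⟩ }, rfl⟩

/-- **`𝔤(𝔞_{2,0}, M_hor) ⊂ 𝔤𝔩(M)_0(ad h_ver)`**: every element of `𝔤(𝔞_{2,0}, M_hor)` commutes with `h_ver = h - h_hor`
— the generators do: `𝔞_{2,0}` has bidegree `(2, 0)`, and the partner `f_x` of `(x, h_hor, f_x)` commutes with
`h_ver` because `x` and `h_hor` do ("the last member is a rational expression in the first two": a vector killed by
`e` and `h'` of an `𝔰𝔩₂`-triple is killed by `f`, A1-143 `lie_eq_zero_of_isSl2Triple_of_lie_eq_zero`, here in the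
adjoint module). [cite: LooijengaLunts1997, §5 (5.3) Proposition, p. 21 L41–L43, proof L57–L63] -/
theorem IsLefschetzModule.lefschetzLieAlgebra_horizontalTwoZero_le_adDegree_zero (A : IsLefschetzModule K h 𝔞)
    (hH𝔤 : H ∈ lefschetzLieAlgebra K h 𝔞) (hH : IsZGrading H) (hHh : H ∈ adDegree K h 0) :
    (lefschetzLieAlgebra K H (horizontalTwoZero H 𝔞)).toSubmodule ≤
      (lefschetzLieAlgebra K h 𝔞).toSubmodule ⊓ adDegree K (h - H) 0 := by
  obtain ⟨C, hC⟩ := exists_lieSubalgebra_inf_adDegree_zero (lefschetzLieAlgebra K h 𝔞) (h - H)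
  rw [← hC]
  show lefschetzLieAlgebra K H (horizontalTwoZero H 𝔞) ≤ C
  rw [lefschetzLieAlgebra_le_iff]
  have hWH : ⁅h - H, H⁆ = 0 := by
    rw [sub_lie, lie_self, sub_zero, mem_adDegree_iff.1 hHh, zero_smul]
  refine ⟨fun x hx ↦ ?_, ?_⟩
  · rw [SetLike.mem_coe, ← LieSubalgebra.mem_toSubmodule, hC]
    exact Submodule.mem_inf.2 ⟨horizontalTwoZero_le_lefschetzLieAlgebra hH𝔤 hx,
      horizontalTwoZero_le_adDegree_sub_zero hH hHh A.le_adDegree_two hx⟩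
  · rintro f ⟨x, hx, t⟩
    rw [SetLike.mem_coe, ← LieSubalgebra.mem_toSubmodule, hC]
    refine Submodule.mem_inf.2
      ⟨A.mem_lefschetzLieAlgebra_of_isSl2Triple hH𝔤 (horizontalTwoZero_le_lefschetzLieAlgebra hH𝔤 hx) t, ?_⟩
    have hWx : ⁅h - H, x⁆ = 0 := by
      rw [mem_adDegree_iff.1 (horizontalTwoZero_le_adDegree_sub_zero hH hHh A.le_adDegree_two hx), zero_smul]
    -- "the last member is a rational expression in the first two": `h_ver` is killed by `ad x` and `ad h_hor`, hence
    -- by `ad f` (A1-143 `lie_eq_zero_of_isSl2Triple_of_lie_eq_zero` for the adjoint module)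
    have h1 := lie_eq_zero_of_isSl2Triple_of_lie_eq_zero K t (v := h - H) (by rw [← lie_skew, hWx, neg_zero])
      (by rw [← lie_skew, hWH, neg_zero])
    rw [mem_adDegree_iff, zero_smul, ← lie_skew, h1, neg_zero]

/-- **LOOIJENGA–LUNTS (5.3): "`𝔤(𝔞_{2,0}, M_hor)` is a subalgebra of `𝔤(𝔞, M)_{•,0}`"** — with `𝔤(𝔞, M)_{k,l}` the
adjoint bidegree spaces of `(h_hor, h_ver)` (A1-147 §3): `𝔤(𝔞_{2,0}, M_hor) ⊆ ⊕_k 𝔤(𝔞, M) ∩ 𝔤𝔩(M)_k(ad h_hor) ∩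
𝔤𝔩(M)_0(ad h_ver)`. [cite: LooijengaLunts1997, §5 (5.3) Proposition, p. 21 L41–L43] -/
theorem IsLefschetzModule.lefschetzLieAlgebra_horizontalTwoZero_le_iSup (A : IsLefschetzModule K h 𝔞)
    (hH𝔤 : H ∈ lefschetzLieAlgebra K h 𝔞) (hH : IsZGrading H) (hHh : H ∈ adDegree K h 0) :
    (lefschetzLieAlgebra K H (horizontalTwoZero H 𝔞)).toSubmodule ≤
      ⨆ k : ℤ, (lefschetzLieAlgebra K h 𝔞).toSubmodule ⊓ (adDegree K H (k : K) ⊓ adDegree K (h - H) 0) := by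
  have hWH : (h - H) ∈ adDegree K H 0 := by
    rw [mem_adDegree_iff, zero_smul, lie_sub, lie_self, sub_zero, ← lie_skew, mem_adDegree_iff.1 hHh, zero_smul,
      neg_zero]
  -- `U = 𝔤(𝔞, M) ∩ 𝔤𝔩(M)_0(ad h_ver)` is `ad h_hor`-stable, hence graded by `ad h_hor` (A1-148 §6)
  set U : Submodule K (Module.End K M) := (lefschetzLieAlgebra K h 𝔞).toSubmodule ⊓ adDegree K (h - H) 0 with hU
  have hUs : ∀ x ∈ U, LieAlgebra.ad K (Module.End K M) H x ∈ U := fun x hx ↦ by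
    rw [LieAlgebra.ad_apply]
    refine ⟨(lefschetzLieAlgebra K h 𝔞).lie_mem hH𝔤 hx.1, ?_⟩
    have h0 : H ∈ adDegree K (h - H) 0 := by
      rw [mem_adDegree_iff, zero_smul, sub_lie, lie_self, sub_zero, mem_adDegree_iff.1 hHh, zero_smul]
    have h1 := lie_mem_adDegree h0 hx.2
    rwa [add_zero] at h1
  have hUeq := eq_iSup_inf_degreeSpace_of_forall_mem hH.ad hUs
  refine (A.lefschetzLieAlgebra_horizontalTwoZero_le_adDegree_zero hH𝔤 hH hHh).trans ?_
  rw [← hU]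
  refine hUeq.le.trans (iSup_le fun k ↦ le_iSup_of_le k ?_)
  rw [hU, degreeSpace_ad_eq_adDegree]
  exact fun x hx ↦ ⟨hx.1.1, hx.2, hx.1.2⟩

/-- **LOOIJENGA–LUNTS (5.3): `𝔞_{2,0}` "has the Lefschetz property in `M` with respect to the horizontal grading"**, in
the model `Gr_hor M ≅ (M, h_hor)`: if some `a ∈ 𝔞_hor` acts on `Gr_hor M` — i.e. its lowest component `a_2` acts on
`(M, H)` (§2 `apply_sub_degreeComponent_apply_mem_horFiltration`) — with the Lefschetz property, then `a_2 ∈ 𝔞_{2,0}`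
is a Lefschetz element of `(𝔞_{2,0}, M_hor)`: the domain of `f` on `𝔞_{2,0}` (with respect to `H`) is non-empty.
[cite: LooijengaLunts1997, §5 (5.3) Proposition, p. 21 L33–L34, L39–L41] -/
theorem nonempty_lefschetzDomain_horizontalTwoZero (hH : IsZGrading H) (hH0 : H ≠ 0) {a : Module.End K M}
    (ha : a ∈ horizontalPart H 𝔞)
    (hL : HasLefschetzProperty H (degreeComponent (LieAlgebra.ad K (Module.End K M) H) 2 a)) :
    (lefschetzDomain K H (horizontalTwoZero H 𝔞)).Nonempty :=
  ⟨_, (mem_lefschetzDomain_iff_hasLefschetzProperty hH hH0 (degreeComponent_mem_horizontalTwoZero ha)).2 hL⟩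

/-- **LOOIJENGA–LUNTS (5.3), the horizontal Lefschetz module `(𝔞_{2,0}, M_hor)`.**  Printed hypothesis: "suppose that
`Gr_hor M` is a Lefschetz module of `𝔞_hor`"; printed conclusions: `𝔞_{2,0}` is abelian, of bidegree `(2,0)`, has the
Lefschetz property in `M` with respect to the horizontal grading, and `𝔤(𝔞_{2,0}, M_hor)` "maps isomorphically onto
`𝔤(𝔞_hor, Gr_hor M)`".  In the model of A1-148 (`Gr_hor M` identified with `M` graded by `h_hor`, under which `𝔞_hor`
acts through `a ↦ a_2`, §2), the hypothesis reads: some `a_2`, `a ∈ 𝔞_hor`, is a Lefschetz operator of `(M, H)` and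
`𝔤(𝔞_{2,0}, M_hor) = 𝔤(𝔞_hor, Gr_hor M)` is semisimple; conclusion: `(𝔞_{2,0}, M_hor)` is a Lefschetz module in the
sense of A1-88 (`IsLefschetzModule K H 𝔞_{2,0}`). [cite: LooijengaLunts1997, §5 (5.3) Proposition, p. 21 L32–L43] -/
theorem IsLefschetzModule.isLefschetzModule_horizontalTwoZero (A : IsLefschetzModule K h 𝔞) (hH : IsZGrading H)
    (hH0 : H ≠ 0) {a : Module.End K M} (ha : a ∈ horizontalPart H 𝔞)
    (hL : HasLefschetzProperty H (degreeComponent (LieAlgebra.ad K (Module.End K M) H) 2 a))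
    (hss : LieAlgebra.IsSemisimple K (lefschetzLieAlgebra K H (horizontalTwoZero H 𝔞))) :
    IsLefschetzModule K H (horizontalTwoZero H 𝔞) where
  isZGrading := hH
  le_adDegree_two := horizontalTwoZero_le_adDegree hH
  lie_eq_zero := fun _ hx _ hy ↦ lie_eq_zero_of_mem_horizontalTwoZero hH A.lie_eq_zero hx hy
  nonempty_lefschetzDomain := nonempty_lefschetzDomain_horizontalTwoZero hH hH0 ha hL
  isSemisimple := hss

end LefschetzModule

end Literature.Algebra.Lie
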